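import Literature.NumberTheory.Transcendental.NesterenkoHilbertBoundOrder
import Literature.RingTheory.MvPolynomial.HomogeneousHilbertFunction
import Mathlib.RingTheory.Norm.Basic
import Mathlib.Data.List.Perm.Basic
import Mathlib.Analysis.SpecialFunctions.Pow.Real
import HarnessLib

/-!
# Nesterenko's bound for the Hilbert function of a homogeneous prime ideal (LNM 1752 Ch. 10 Lemma 3.1, absolute case)

`Literature/NumberTheory/Transcendental/NesterenkoHilbertBound.lean`. For a homogeneous prime
`𝔭 ⊂ ℚ[x₀, …, x_m]` of rank `s + 1` (projective dimension `s`) with a chart `x_j ∉ 𝔭`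
(`𝒢 : GSec m`) and every `ν`,

  **`H(𝔭; ν) = dim_ℚ ℚ[x̲]_ν − dim_ℚ 𝔭_ν ≤ deg 𝔭 · #{k ∈ ℕ^s : |k| ≤ sν} ≤ deg 𝔭 · (sν + 1)^s`**

(`finrank_homogeneousSubmodule_le`, `hilbert_le`), the absolute (constant-field, height-free) case
of [Nes3] Thm 1 = LNM 1752 Ch. 10 Lemma 3.1 (`χ_𝔭(ν) ≤ γ₁ ν^{r−1} deg 𝔭`, `γ₁` depending only on
`m`); and its use, Ch. 10 Lemma 3.2 (constant field): **if `dim ℚ[x̲]_ν > deg 𝔭 · (sν+1)^s` then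
`𝔭` contains a non-zero form of degree `ν`** (`exists_isHomogeneous_mem_ne_zero`). The rank-one
case (`s = 0`) reads `H(𝔭; ν) ≤ deg 𝔭`.

## The proof ([Nes3] §§2–3, specialised to the constant field; one generic point)

Notation of `NesterenkoHilbertBoundOrder.lean`: `K' = ℚ(U')`, `𝕃₀ = K'(ρ)` with `K'`-basis `b`,
coordinates `crd_i`, `D = [𝕃₀ : K'] = deg 𝔭`, the order `O ⊂ 𝕃₀` with `O0 = A[1/denD] ⊂ K'`,
the derivations `∂̃_c` (`dLO`) / `∂_c` (`dO0`), `c = (p, q) ∈ C = [s] × [m+1]`, and the specialisation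
`τ : O0 → ℚ`. Consider the `ℚ`-linear map
`φ : R ↦ (τ(crd_i(∂̃^k R(ρ))))_{i < D, k ∈ ℕ^s, |k| ≤ sν}` (`phi`), where `∂̃^k` is the iterated
derivative along the CHART directions `(p, j)` counted by `k`. CLAIM (`mem_of_phi_eq_zero`): a form
`R` of degree `ν` with `φ(R) = 0` lies in `𝔭`. Granting it, `H(𝔭; ν) ≤ dim(target) = D · #k`
(rank–nullity, `finrank_homogeneousSubmodule_le`).

Proof of the claim, for `R ∉ 𝔭` towards a contradiction, with `y = R(ρ) ∈ O` and `n = sν`: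
* (A) `φ(R) = 0` says the coordinates of the CHART derivatives of `y` of order `≤ n` specialise to
  `0`; by Nesterenko's Lemma 1 (`∂̃_{pq} R(ρ) = ρ_q ∂̃_{pj} R(ρ)`, `dLO_aevalO`), commutation of the
  `∂̃_c` and the higher Leibniz rule, every mixed derivative `∂̃_w y` (`|w| ≤ n`) lies in the
  `O`-span of the chart derivatives of order `≤ n` (`iterD_mem_chartSpan`), so ALL coordinates of all
  derivatives of `y` of order `≤ n` specialise to `0` (`CVan_of_chart`);
* (B) then every coordinate `crd_i y ∈ O0` vanishes to order `n` under `τ` along the `∂_c`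
  (`van_crdO_of_CVan`, induction on `n` through `∂_c(crd_i y) = crd_i(∂̃_c y) − ∑ T_c(i,i') crd_{i'} y`);
* (C–D) the entries of the matrix of multiplication by `y` are `O0`-combinations of the `crd_i y`,
  so its determinant `N_{𝕃₀/K'}(y)` vanishes to order `D(n+1) − 1` (pigeonhole Leibniz,
  `VanUpTo.det`);
* (E–F) `a^ν N(y) = G_R = normFormPoly R ν ∈ A` has total degree `≤ s D ν ≤ D(n+1) − 1`
  (`totalDegree_normFormPoly_le`), and all its partial derivatives of that order vanish at
  `uspec` (`tau_iterD_algebraMap`), so it is `0` (Taylor) — contradicting `G_R ≠ 0` for `R ∉ 𝔭`.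

## References

* [NesterenkoPhilippon2001] Yu. V. Nesterenko, P. Philippon (eds.), LNM 1752, Ch. 10 (Nesterenko)
  Lemma 3.1 and Lemma 3.2 (pp. 153–154); Ch. 9 (Bertrand) (32) for the sharper geometric bound.
* [Nes3] Yu. V. Nesterenko, *Estimates for the characteristic function of a prime ideal*,
  Mat. Sb. 123 (165) (1984) 11–34; Math. USSR Sb. 51 (1985) 9–32, Thm 1.
* Zhu Yaochen, *Transcendental numbers: algebraic independence* (2008), App. 3 (an exposition of
  [Nes3]).
-/

noncomputable section

set_option synthInstance.maxHeartbeats 400000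

open MvPolynomial Module
open Literature.RingTheory.MvPolynomial

attribute [local instance] MvPolynomial.gradedAlgebra

namespace Literature.NumberTheory.Transcendental

namespace Nesterenko

variable {m : ℕ}

/-! ### Two generic complements on iterated derivations -/

/-- Vanishing to order `n + 1` is: the value vanishes and every first derivative vanishes to order
`n` (split a word as `w' ++ [c]`). [folklore] -/
theorem vanUpTo_succ_iff {R C B T : Type*} [CommRing R] [CommRing B] [Algebra R B] [CommRing T]
    {τ : B →+* T} {δ : C → Derivation R B B} {n : ℕ} {x : B} :
    VanUpTo τ δ (n + 1) x ↔ τ x = 0 ∧ ∀ c, VanUpTo τ δ n (δ c x) := by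
  refine ⟨fun h => ⟨h.apply_eq_zero, fun c => h.deriv c⟩, fun ⟨h0, h1⟩ w hw => ?_⟩
  rcases List.eq_nil_or_concat w with rfl | ⟨w', c, rfl⟩
  · exact h0
  · rw [List.concat_eq_append] at hw ⊢
    rw [iterD_append]
    rw [List.length_append, List.length_singleton] at hw
    exact h1 c w' (by omega)

/-- For pairwise commuting maps, the iterate along a word only depends on the word up to
permutation. [folklore] -/
theorem iterD_perm {C B : Type*} (δ : C → B → B) (hcomm : ∀ c c' x, δ c (δ c' x) = δ c' (δ c x))
    {w w' : List C} (h : w.Perm w') (x : B) : iterD δ w x = iterD δ w' x := by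
  induction h generalizing x with
  | nil => rfl
  | cons c _ ih => rw [iterD_cons, iterD_cons, ih]
  | swap c c' l => rw [iterD_cons, iterD_cons, iterD_cons, iterD_cons, hcomm]
  | trans _ _ ih₁ ih₂ => rw [ih₁, ih₂]

/-- A constant of all the derivations can be pulled out of an iterated derivative. [folklore] -/
theorem iterD_const_mul {R C B : Type*} [CommRing R] [CommRing B] [Algebra R B]
    (δ : C → Derivation R B B) {a : B} (ha : ∀ c, δ c a = 0) (w : List C) (z : B) :
    iterD (dmap δ) w (a * z) = a * iterD (dmap δ) w z := by
  induction w with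
  | nil => rfl
  | cons c w ih =>
    rw [iterD_cons, iterD_cons, ih, dmap, (δ c).leibniz, ha c, smul_zero, add_zero, smul_eq_mul]

namespace GSec

variable (𝒢 : GSec m)

/-! ### Orders of vanishing under the specialisation -/

/-- `van n x`: `x ∈ O0` vanishes to order `n` under `τ` along the `∂_c`. [folklore] -/
def van (n : ℕ) (x : 𝒢.O0) : Prop := VanUpTo 𝒢.tau 𝒢.dO0 n x

/-- Iterated derivatives inside `O`: `iterDO w y = ∂̃_w y`. [folklore] -/
def iterDO (w : List (Fin 𝒢.s × Fin (m + 1))) (y : 𝒢.O) : 𝒢.O := iterD (dmap 𝒢.dLO) w y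

/-- `iterDO` unfolded. [folklore] -/
theorem iterDO_def (w : List (Fin 𝒢.s × Fin (m + 1))) (y : 𝒢.O) : 𝒢.iterDO w y = iterD (dmap 𝒢.dLO) w y :=
  rfl

/-- The empty word. [folklore] -/
@[simp] theorem iterDO_nil (y : 𝒢.O) : 𝒢.iterDO [] y = y := rfl

/-- One more letter. [folklore] -/
theorem iterDO_cons (c : Fin 𝒢.s × Fin (m + 1)) (w : List (Fin 𝒢.s × Fin (m + 1))) (y : 𝒢.O) :
    𝒢.iterDO (c :: w) y = 𝒢.dLO c (𝒢.iterDO w y) := rfl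

/-- Concatenation. [folklore] -/
theorem iterDO_append (w₁ w₂ : List (Fin 𝒢.s × Fin (m + 1))) (y : 𝒢.O) :
    𝒢.iterDO (w₁ ++ w₂) y = 𝒢.iterDO w₁ (𝒢.iterDO w₂ y) :=
  iterD_append _ w₁ w₂ y

/-- Additivity. [folklore] -/
theorem iterDO_add (w : List (Fin 𝒢.s × Fin (m + 1))) (y z : 𝒢.O) :
    𝒢.iterDO w (y + z) = 𝒢.iterDO w y + 𝒢.iterDO w z :=
  iterD_add _ w y z

/-- The higher Leibniz rule. [folklore] -/
theorem iterDO_mul (w : List (Fin 𝒢.s × Fin (m + 1))) (y z : 𝒢.O) :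
    𝒢.iterDO w (y * z) = ((splits w).map fun P => 𝒢.iterDO P.1 y * 𝒢.iterDO P.2 z).sum :=
  iterD_mul _ w y z

/-- A constant of all `∂̃_c` factors out. [folklore] -/
theorem iterDO_const_mul {a : 𝒢.O} (ha : ∀ c, 𝒢.dLO c a = 0) (w : List (Fin 𝒢.s × Fin (m + 1)))
    (z : 𝒢.O) : 𝒢.iterDO w (a * z) = a * 𝒢.iterDO w z :=
  iterD_const_mul _ ha w z

/-- Words equal up to permutation give the same iterate (the `∂̃_c` commute). [folklore] -/
theorem iterDO_perm {w w' : List (Fin 𝒢.s × Fin (m + 1))} (h : w.Perm w') (y : 𝒢.O) :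
    𝒢.iterDO w y = 𝒢.iterDO w' y :=
  iterD_perm _ (fun c c' x => 𝒢.dLO_comm c c' x) h y

/-- `CVan n y`: every coordinate of every iterated derivative of `y ∈ O` of order `≤ n` specialises
to `0`. [folklore] -/
def CVan (n : ℕ) (y : 𝒢.O) : Prop :=
  ∀ w : List (Fin 𝒢.s × Fin (m + 1)), w.length ≤ n →
    ∀ i, 𝒢.tau (𝒢.crdO i (𝒢.iterDO w y)) = 0

/-- `CVan` is monotone in the order. [folklore] -/
theorem CVan.mono {n n' : ℕ} (h : n' ≤ n) {y : 𝒢.O} (hy : 𝒢.CVan n y) : 𝒢.CVan n' y :=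
  fun w hw => hy w (hw.trans h)

/-- `CVan (n+1)` is: the coordinates vanish and every first derivative is `CVan n`. [folklore] -/
theorem CVan_succ_iff {n : ℕ} {y : 𝒢.O} :
    𝒢.CVan (n + 1) y ↔ (∀ i, 𝒢.tau (𝒢.crdO i y) = 0) ∧ ∀ c, 𝒢.CVan n (𝒢.dLO c y) := by
  refine ⟨fun h => ⟨fun i => h [] (Nat.zero_le _) i, fun c w hw i => ?_⟩, fun ⟨h0, h1⟩ w hw i => ?_⟩
  · have := h (w ++ [c]) (by simp; omega) i
    rwa [iterDO_append] at this
  · rcases List.eq_nil_or_concat w with rfl | ⟨w', c, rfl⟩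
    · exact h0 i
    · rw [List.concat_eq_append] at hw ⊢
      rw [iterDO_append]
      rw [List.length_append, List.length_singleton] at hw
      exact h1 c w' (by omega) i

/-- **Step B.** If all coordinates of all derivatives of `y` of order `≤ n` specialise to `0`, then
every coordinate of `y` vanishes to order `n` along the `∂_c` (induction on `n` through
`∂_c(crd_i y) = crd_i(∂̃_c y) − ∑ T_c(i,i') crd_{i'}(y)`).
[cite: NesterenkoPhilippon2001, Ch. 10 Lemma 3.1, via [Nes3] §3] -/
theorem van_crdO_of_CVan : ∀ (n : ℕ) (y : 𝒢.O), 𝒢.CVan n y → ∀ i, 𝒢.van n (𝒢.crdO i y)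
  | 0, y, h, i => fun w hw => by
    rw [Nat.le_zero, List.length_eq_zero_iff] at hw
    subst hw
    exact h [] le_rfl i
  | n + 1, y, h, i => by
    rw [van, vanUpTo_succ_iff]
    obtain ⟨h0, hc⟩ := 𝒢.CVan_succ_iff.mp h
    refine ⟨h0 i, fun c => ?_⟩
    rw [dO0_crdO]
    have hA : 𝒢.van n (𝒢.crdO i (𝒢.dLO c y)) := van_crdO_of_CVan n _ (hc c) i
    have hB : ∀ i', 𝒢.van n (𝒢.crdO i' y) :=
      van_crdO_of_CVan n y (CVan.mono 𝒢 (Nat.le_succ n) h)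
    exact hA.sub (VanUpTo.sum fun i' _ => (hB i').mul_left _)

/-! ### Step A: by Lemma 1, the chart derivatives control all derivatives -/

/-- Chart words: all letters are chart directions `(p, j)`. [folklore] -/
def IsChartWord (w : List (Fin 𝒢.s × Fin (m + 1))) : Prop := ∀ c ∈ w, c.2 = 𝒢.j

/-- The `O`-span (an ideal of `O`) of the chart derivatives of `y` of order `≤ n`. [folklore] -/
def chartSpan (n : ℕ) (y : 𝒢.O) : Ideal 𝒢.O :=
  Ideal.span {z | ∃ w', 𝒢.IsChartWord w' ∧ w'.length ≤ n ∧ z = 𝒢.iterDO w' y}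

/-- `chartSpan` is monotone in the order. [folklore] -/
theorem chartSpan_mono {n n' : ℕ} (h : n ≤ n') (y : 𝒢.O) : 𝒢.chartSpan n y ≤ 𝒢.chartSpan n' y :=
  Ideal.span_mono fun _ ⟨w', hw', hlen, hz⟩ => ⟨w', hw', hlen.trans h, hz⟩

/-- Chart derivatives lie in the span. [folklore] -/
theorem iterD_mem_chartSpan_of_isChartWord {w' : List (Fin 𝒢.s × Fin (m + 1))} (hw' : 𝒢.IsChartWord w')
    {n : ℕ} (hlen : w'.length ≤ n) (y : 𝒢.O) : 𝒢.iterDO w' y ∈ 𝒢.chartSpan n y :=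
  Ideal.subset_span ⟨w', hw', hlen, rfl⟩

/-- Letters of the parts of a splitting are letters of the word. [folklore] -/
theorem mem_of_mem_splits {C : Type*} {w : List C} {P : List C × List C} (hP : P ∈ splits w) :
    (∀ c ∈ P.1, c ∈ w) ∧ (∀ c ∈ P.2, c ∈ w) := by
  induction w generalizing P with
  | nil =>
    simp only [splits_nil, List.mem_singleton] at hP
    subst hP; simp
  | cons a w ih =>
    simp only [splits_cons, List.mem_flatMap, List.mem_cons, List.not_mem_nil, or_false] at hP
    obtain ⟨Q, hQ, rfl | rfl⟩ := hP
    · obtain ⟨h1, h2⟩ := ih hQ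
      exact ⟨fun c hc => by
        rcases List.mem_cons.mp hc with rfl | hc
        · exact List.mem_cons_self
        · exact List.mem_cons_of_mem _ (h1 c hc), fun c hc => List.mem_cons_of_mem _ (h2 c hc)⟩
    · obtain ⟨h1, h2⟩ := ih hQ
      exact ⟨fun c hc => List.mem_cons_of_mem _ (h1 c hc), fun c hc => by
        rcases List.mem_cons.mp hc with rfl | hc
        · exact List.mem_cons_self
        · exact List.mem_cons_of_mem _ (h2 c hc)⟩

/-- Iterated derivatives commute with each derivation. [folklore] -/
theorem dLO_iterD (c : Fin 𝒢.s × Fin (m + 1)) (w : List (Fin 𝒢.s × Fin (m + 1))) (y : 𝒢.O) :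
    𝒢.dLO c (𝒢.iterDO w y) = 𝒢.iterDO w (𝒢.dLO c y) := by
  induction w with
  | nil => rw [iterDO_nil, iterDO_nil]
  | cons c' w ih =>
    -- term-mode chain (a `rw` here triggers an expensive definitional unfolding of `∂̃_c`)
    exact (congrArg (𝒢.dLO c) (𝒢.iterDO_cons c' w y)).trans ((𝒢.dLO_comm c c' _).trans
      ((congrArg (𝒢.dLO c') ih).trans (𝒢.iterDO_cons c' w (𝒢.dLO c y)).symm))

set_option maxHeartbeats 800000 in
/-- **A derivative of a chart derivative of `R(ρ)` lies in the span of chart derivatives of one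
order more** (for a chart direction trivially; for `c = (p, q)`, `q ≠ j`, by Lemma 1
`∂̃_{pq} R(ρ) = ρ_q ∂̃_{pj} R(ρ)`, commutation and the higher Leibniz rule).
[cite: NesterenkoPhilippon2001, Ch. 10 Lemma 3.1, via [Nes3] Lemma 3] -/
theorem dLO_iterD_mem_chartSpan (R : Rx m) (p : Fin 𝒢.s) (q : Fin (m + 1))
    {w' : List (Fin 𝒢.s × Fin (m + 1))} (hw' : 𝒢.IsChartWord w') {n : ℕ} (hlen : w'.length ≤ n) :
    (𝒢.dLO (p, q) (𝒢.iterDO w' (𝒢.aevalO R)) : 𝒢.O) ∈ 𝒢.chartSpan (n + 1) (𝒢.aevalO R) := by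
  by_cases hq : q = 𝒢.j
  · subst hq
    change 𝒢.iterDO ((p, 𝒢.j) :: w') (𝒢.aevalO R) ∈ _
    refine 𝒢.iterD_mem_chartSpan_of_isChartWord (fun c hc => ?_) ?_ _
    · rcases List.mem_cons.mp hc with rfl | hc
      · rfl
      · exact hw' c hc
    · rw [List.length_cons]; omega
  · rw [dLO_iterD, dLO_aevalO 𝒢 p hq R, iterDO_mul]
    refine list_sum_mem fun t ht => ?_
    obtain ⟨P, hP, rfl⟩ := List.mem_map.mp ht
    refine Ideal.mul_mem_left _ _ ?_
    have hlen' := length_add_length_of_mem_splits hP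
    obtain ⟨-, h2⟩ := mem_of_mem_splits hP
    have e : 𝒢.iterDO P.2 (𝒢.dLO (p, 𝒢.j) (𝒢.aevalO R)) =
        𝒢.iterDO (P.2 ++ [(p, 𝒢.j)]) (𝒢.aevalO R) := by
      rw [iterDO_append]; rfl
    rw [e]
    refine 𝒢.iterD_mem_chartSpan_of_isChartWord (fun c hc => ?_) ?_ _
    · rcases List.mem_append.mp hc with hc | hc
      · exact hw' c (h2 c hc)
      · rw [List.mem_singleton.mp hc]
    · rw [List.length_append, List.length_singleton]; omega

set_option maxHeartbeats 800000 in
/-- **The span of chart derivatives of `R(ρ)` is stable under every `∂̃_c`, up to raising the order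
by one.** [cite: NesterenkoPhilippon2001, Ch. 10 Lemma 3.1, via [Nes3] Lemma 3] -/
theorem dLO_mem_chartSpan (R : Rx m) (c : Fin 𝒢.s × Fin (m + 1)) {n : ℕ} {z : 𝒢.O}
    (hz : z ∈ 𝒢.chartSpan n (𝒢.aevalO R)) : (𝒢.dLO c z : 𝒢.O) ∈ 𝒢.chartSpan (n + 1) (𝒢.aevalO R) := by
  refine Submodule.span_induction
    (p := fun z _ => (𝒢.dLO c z : 𝒢.O) ∈ 𝒢.chartSpan (n + 1) (𝒢.aevalO R)) ?_ ?_ ?_ ?_ hz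
  · rintro z ⟨w', hw', hlen, rfl⟩
    obtain ⟨p, q⟩ := c
    exact 𝒢.dLO_iterD_mem_chartSpan R p q hw' hlen
  · rw [map_zero]; exact Ideal.zero_mem _
  · intro z₁ z₂ _ _ h₁ h₂
    rw [map_add]; exact Ideal.add_mem _ h₁ h₂
  · intro a z hz ih
    rw [smul_eq_mul, (𝒢.dLO c).leibniz, smul_eq_mul, smul_eq_mul]
    exact Ideal.add_mem _ (Ideal.mul_mem_left _ _ ih)
      (Ideal.mul_mem_right _ _ (𝒢.chartSpan_mono (Nat.le_succ n) _ hz))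

/-- **Every derivative of `R(ρ)` lies in the `O`-span of the chart derivatives of at most the same
order.** [cite: NesterenkoPhilippon2001, Ch. 10 Lemma 3.1, via [Nes3] Lemma 3] -/
theorem iterD_mem_chartSpan (R : Rx m) (w : List (Fin 𝒢.s × Fin (m + 1))) :
    𝒢.iterDO w (𝒢.aevalO R) ∈ 𝒢.chartSpan w.length (𝒢.aevalO R) := by
  induction w with
  | nil => exact 𝒢.iterD_mem_chartSpan_of_isChartWord (w' := []) (fun c hc => by simp at hc) le_rfl _
  | cons c w ih =>
    rw [iterDO_cons, List.length_cons]
    exact 𝒢.dLO_mem_chartSpan R c ih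

/-- **Vanishing transfers along the span**: if the coordinates of the chart derivatives of `R(ρ)`
of order `≤ n` specialise to `0`, so do the coordinates of every element of their `O`-span
(`τ` is a ring homomorphism and coordinates of products are `O0`-bilinear). [folklore] -/
theorem tau_crdO_eq_zero_of_mem_chartSpan (R : Rx m) {n : ℕ}
    (h : ∀ w', 𝒢.IsChartWord w' → w'.length ≤ n →
      ∀ i, 𝒢.tau (𝒢.crdO i (𝒢.iterDO w' (𝒢.aevalO R))) = 0)
    {z : 𝒢.O} (hz : z ∈ 𝒢.chartSpan n (𝒢.aevalO R)) : ∀ i, 𝒢.tau (𝒢.crdO i z) = 0 := by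
  refine Submodule.span_induction (p := fun z _ => ∀ i, 𝒢.tau (𝒢.crdO i z) = 0) ?_ ?_ ?_ ?_ hz
  · rintro z ⟨w', hw', hlen, rfl⟩ i
    exact h w' hw' hlen i
  · intro i; rw [crdO_zero, map_zero]
  · intro z₁ z₂ _ _ h₁ h₂ i
    rw [crdO_add, map_add, h₁, h₂, add_zero]
  · intro a z _ ih i
    rw [smul_eq_mul, crdO_mul, map_sum]
    refine Finset.sum_eq_zero fun i' _ => ?_
    rw [map_sum]
    refine Finset.sum_eq_zero fun i'' _ => ?_
    rw [map_mul, map_mul, ih i'', mul_zero, zero_mul]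

/-- **Step A**: the vanishing of the specialised coordinates of the CHART derivatives of `R(ρ)` of
order `≤ n` implies that of ALL derivatives of order `≤ n`.
[cite: NesterenkoPhilippon2001, Ch. 10 Lemma 3.1, via [Nes3] Lemma 3] -/
theorem CVan_of_chart (R : Rx m) {n : ℕ}
    (h : ∀ w', 𝒢.IsChartWord w' → w'.length ≤ n →
      ∀ i, 𝒢.tau (𝒢.crdO i (𝒢.iterDO w' (𝒢.aevalO R))) = 0) :
    𝒢.CVan n (𝒢.aevalO R) := fun w hw i =>
  𝒢.tau_crdO_eq_zero_of_mem_chartSpan R h (𝒢.chartSpan_mono hw _ (𝒢.iterD_mem_chartSpan R w)) i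

/-! ### Chart words and multi-indices -/

/-- The canonical chart word of a multi-index `k ∈ ℕ^s`: `(0,j)^{k₀} (1,j)^{k₁} ⋯`. [folklore] -/
def canWord (k : Fin 𝒢.s → ℕ) : List (Fin 𝒢.s × Fin (m + 1)) :=
  (List.finRange 𝒢.s).flatMap fun p => List.replicate (k p) (p, 𝒢.j)

/-- The canonical word is a chart word. [folklore] -/
theorem isChartWord_canWord (k : Fin 𝒢.s → ℕ) : 𝒢.IsChartWord (𝒢.canWord k) := by
  intro c hc
  simp only [canWord, List.mem_flatMap, List.mem_replicate] at hc
  obtain ⟨p, -, -, rfl⟩ := hc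
  rfl

/-- The length of the canonical word is `|k|`. [folklore] -/
theorem length_canWord (k : Fin 𝒢.s → ℕ) : (𝒢.canWord k).length = ∑ p, k p := by
  rw [canWord, List.length_flatMap]
  simp only [List.length_replicate]
  rw [← List.sum_ofFn, List.ofFn_eq_map]

/-- Letter counts in the canonical word. [folklore] -/
theorem count_canWord (k : Fin 𝒢.s → ℕ) (c : Fin 𝒢.s × Fin (m + 1)) :
    (𝒢.canWord k).count c = if c.2 = 𝒢.j then k c.1 else 0 := by
  classical
  rw [canWord, List.count_flatMap]
  have hsum : ((List.finRange 𝒢.s).map (List.count c ∘ fun p => List.replicate (k p) (p, 𝒢.j))).sum =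
      ∑ p : Fin 𝒢.s, if (p, 𝒢.j) = c then k p else 0 := by
    rw [← List.sum_ofFn, List.ofFn_eq_map]
    congr 1
    refine List.map_congr_left fun p _ => ?_
    rw [Function.comp_apply, List.count_replicate]
    simp
  rw [hsum]
  obtain ⟨c1, c2⟩ := c
  by_cases hc2 : c2 = 𝒢.j
  · subst hc2
    rw [if_pos rfl]
    rw [Finset.sum_eq_single c1 (fun p _ hp => if_neg fun h => hp (Prod.ext_iff.mp h).1)
      (fun h => absurd (Finset.mem_univ c1) h), if_pos rfl]
  · rw [if_neg hc2]
    refine Finset.sum_eq_zero fun p _ => ?_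
    rw [if_neg]
    exact fun h => hc2 (Prod.ext_iff.mp h).2.symm

/-- The chart-letter counts of a word. [folklore] -/
def chartCount (w : List (Fin 𝒢.s × Fin (m + 1))) (p : Fin 𝒢.s) : ℕ := w.count (p, 𝒢.j)

/-- **A chart word is a permutation of the canonical word of its letter counts.** [folklore] -/
theorem perm_canWord {w : List (Fin 𝒢.s × Fin (m + 1))} (hw : 𝒢.IsChartWord w) :
    w.Perm (𝒢.canWord (𝒢.chartCount w)) := by
  classical
  rw [List.perm_iff_count]
  rintro ⟨c1, c2⟩
  rw [count_canWord]
  split_ifs with hc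
  · change c2 = 𝒢.j at hc
    subst hc
    rfl
  · exact List.count_eq_zero.mpr fun hcw => hc (hw _ hcw)

/-- The letter counts of a chart word add up to its length. [folklore] -/
theorem sum_chartCount {w : List (Fin 𝒢.s × Fin (m + 1))} (hw : 𝒢.IsChartWord w) :
    ∑ p, 𝒢.chartCount w p = w.length := by
  rw [(𝒢.perm_canWord hw).length_eq, length_canWord]

/-- Along a chart word, the iterated derivative is the one along the canonical word of its counts
(the `∂̃_c` commute). [folklore] -/
theorem iterD_eq_iterD_canWord {w : List (Fin 𝒢.s × Fin (m + 1))} (hw : 𝒢.IsChartWord w) (y : 𝒢.O) :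
    𝒢.iterDO w y = 𝒢.iterDO (𝒢.canWord (𝒢.chartCount w)) y :=
  𝒢.iterDO_perm (𝒢.perm_canWord hw) y

/-- The multi-indices `k ∈ ℕ^s` with `|k| ≤ n`, as a finite type (values in `Fin (n+1)`). [folklore] -/
abbrev KIdx (n : ℕ) : Type := {k : Fin 𝒢.s → Fin (n + 1) // ∑ p, (k p : ℕ) ≤ n}

/-- `#{k : |k| ≤ n} ≤ (n+1)^s`. [folklore] -/
theorem card_KIdx_le (n : ℕ) : Fintype.card (𝒢.KIdx n) ≤ (n + 1) ^ 𝒢.s := by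
  refine (Fintype.card_subtype_le _).trans ?_
  rw [Fintype.card_fun, Fintype.card_fin, Fintype.card_fin]

/-! ### The linear map `φ` -/

/-- The value `τ(crd_i(∂̃^k R(ρ)))`. [folklore] -/
def phiFun (n : ℕ) (R : Rx m) (k : 𝒢.KIdx n) (i : Fin 𝒢.gdim) : ℚ :=
  𝒢.tau (𝒢.crdO i (𝒢.iterDO (𝒢.canWord fun p => (k.1 p : ℕ)) (𝒢.aevalO R)))

/-- Every `∂̃_c` kills the rational constants of `O`. [folklore] -/
theorem dLO_ratO (c : Fin 𝒢.s × Fin (m + 1)) (q : ℚ) : 𝒢.dLO c (𝒢.ratO q) = 0 := by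
  refine Subtype.ext ?_
  rw [coe_dLO, ratO, ZeroMemClass.coe_zero]
  have h : 𝒢.dL c (algebraMap 𝒢.Kp 𝒢.L0 (q : 𝒢.Kp)) = algebraMap 𝒢.Kp 𝒢.L0 (𝒢.dK c (q : 𝒢.Kp)) :=
    𝒢.dL_algebraMap c _
  rw [h, ← eq_ratCast ((algebraMap (RU 𝒢.s m) 𝒢.Kp).comp (algebraMap ℚ (RU 𝒢.s m))) q,
    RingHom.comp_apply, dK_algebraMap, MvPolynomial.algebraMap_eq, pderiv_C, map_zero, map_zero]

/-- Coordinates of `ratO q * z`. [folklore] -/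
theorem crdO_ratO_mul (q : ℚ) (z : 𝒢.O) (i : Fin 𝒢.gdim) :
    (𝒢.crdO i (𝒢.ratO q * z) : 𝒢.Kp) = (q : 𝒢.Kp) * 𝒢.crdO i z := by
  rw [coe_crdO, coe_crdO, Subring.coe_mul, ratO]
  change 𝒢.crd i (algebraMap 𝒢.Kp 𝒢.L0 (q : 𝒢.Kp) * (z : 𝒢.L0)) = _
  have e : (q : 𝒢.Kp) • (z : 𝒢.L0) = algebraMap 𝒢.Kp 𝒢.L0 (q : 𝒢.Kp) * (z : 𝒢.L0) :=
    Algebra.smul_def _ _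
  rw [← e, map_smul, smul_eq_mul]

/-- `τ` on rational constants. [folklore] -/
theorem tau_ratCast (q : ℚ) (hq : ((q : 𝒢.Kp)) ∈ 𝒢.O0) : 𝒢.tau ⟨(q : 𝒢.Kp), hq⟩ = q := by
  have : (⟨(q : 𝒢.Kp), hq⟩ : 𝒢.O0) = algebraMap (RU 𝒢.s m) 𝒢.O0 (C q) := Subtype.ext (by
    rw [coe_algebraMap_O0, ← MvPolynomial.algebraMap_eq, ← RingHom.comp_apply, eq_ratCast])
  rw [this, tau_algebraMap, eval_C]

/-- **`φ : R ↦ (τ(crd_i(∂̃^k R(ρ))))_{k, i}`, a `ℚ`-linear map.**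
[cite: NesterenkoPhilippon2001, Ch. 10 Lemma 3.1, via [Nes3] §3 (the map `φ`)] -/
def phi (n : ℕ) : Rx m →ₗ[ℚ] (𝒢.KIdx n → Fin 𝒢.gdim → ℚ) where
  toFun := 𝒢.phiFun n
  map_add' R R' := by
    funext k i
    simp only [phiFun, Pi.add_apply, aevalO_add, iterDO_add, crdO_add, map_add]
  map_smul' q R := by
    funext k i
    simp only [phiFun, Pi.smul_apply, smul_eq_mul, RingHom.id_apply]
    rw [MvPolynomial.smul_eq_C_mul, aevalO_C_mul, 𝒢.iterDO_const_mul (fun c => 𝒢.dLO_ratO c q)]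
    have hmem : ((q : 𝒢.Kp)) ∈ 𝒢.O0 := 𝒢.ratCast_mem_O0 q
    have : 𝒢.crdO i (𝒢.ratO q * 𝒢.iterDO (𝒢.canWord fun p => (k.1 p : ℕ)) (𝒢.aevalO R)) =
        ⟨(q : 𝒢.Kp), hmem⟩ * 𝒢.crdO i (𝒢.iterDO (𝒢.canWord fun p => (k.1 p : ℕ)) (𝒢.aevalO R)) :=
      Subtype.ext (by rw [crdO_ratO_mul]; rfl)
    rw [this, map_mul, tau_ratCast]

/-- `φ` unfolded. [folklore] -/
theorem phi_apply (n : ℕ) (R : Rx m) (k : 𝒢.KIdx n) (i : Fin 𝒢.gdim) :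
    𝒢.phi n R k i = 𝒢.tau (𝒢.crdO i (𝒢.iterDO (𝒢.canWord fun p => (k.1 p : ℕ)) (𝒢.aevalO R))) :=
  rfl

/-! ### The kernel of `φ` on forms of degree `ν` is `𝔭_ν` -/

/-- The matrix of multiplication by `y ∈ O` in the basis `b`, with entries in `O0`:
`M(i, i') = crd_i(y b_{i'}) = ∑_{i''} crd_{i''}(y) crd_i(b_{i''} b_{i'})`. [folklore] -/
def mulMatO (y : 𝒢.O) : Matrix (Fin 𝒢.gdim) (Fin 𝒢.gdim) 𝒢.O0 :=
  fun i i' => ∑ i'', 𝒢.crdO i'' y * 𝒢.scO i i'' i'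

/-- The entries of `mulMatO` are those of Mathlib's `leftMulMatrix`. [folklore] -/
theorem coe_mulMatO (y : 𝒢.O) (i i' : Fin 𝒢.gdim) :
    ((𝒢.mulMatO y i i' : 𝒢.O0) : 𝒢.Kp) = Algebra.leftMulMatrix 𝒢.basisL0 (y : 𝒢.L0) i i' := by
  rw [Algebra.leftMulMatrix_eq_repr_mul, mulMatO]
  simp only [AddSubmonoidClass.coe_finsetSum, MulMemClass.coe_mul, coe_crdO, coe_scO]
  rw [← Basis.coord_apply]
  change _ = 𝒢.crd i ((y : 𝒢.L0) * 𝒢.basisL0 i')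
  conv_rhs => rw [← 𝒢.sum_crd_smul (y : 𝒢.L0)]
  rw [Finset.sum_mul, map_sum]
  refine Finset.sum_congr rfl fun i'' _ => ?_
  rw [smul_mul_assoc, map_smul, smul_eq_mul]

/-- The determinant of `mulMatO y` is the norm `N_{𝕃₀/K'}(y)`. [folklore] -/
theorem coe_det_mulMatO (y : 𝒢.O) :
    (((𝒢.mulMatO y).det : 𝒢.O0) : 𝒢.Kp) = Algebra.norm 𝒢.Kp (y : 𝒢.L0) := by
  have h1 : Algebra.norm 𝒢.Kp (y : 𝒢.L0) = (Algebra.leftMulMatrix 𝒢.basisL0 (y : 𝒢.L0)).det :=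
    Algebra.norm_eq_matrix_det 𝒢.basisL0 _
  rw [h1, show (((𝒢.mulMatO y).det : 𝒢.O0) : 𝒢.Kp) =
    (𝒢.O0.val : 𝒢.O0 →+* 𝒢.Kp) (𝒢.mulMatO y).det from rfl, RingHom.map_det]
  congr 1
  ext i i'
  exact 𝒢.coe_mulMatO y i i'

/-- Over no variables, a polynomial is constant. [folklore] -/
theorem totalDegree_eq_zero_of_isEmpty {σ R : Type*} [CommSemiring R] [IsEmpty σ] (P : MvPolynomial σ R) :
    P.totalDegree = 0 := by
  rw [MvPolynomial.eq_C_of_isEmpty P, totalDegree_C]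

/-- **The degree budget**: `deg (normFormPoly R ν) ≤ D (sν + 1) − 1`. [folklore] -/
theorem totalDegree_normFormPoly_le_budget {R : Rx m} {ν : ℕ} (hR : R.IsHomogeneous ν) (hR0 : R ≠ 0) :
    (𝒢.normFormPoly R ν).totalDegree ≤ 𝒢.gdim * (𝒢.s * ν + 1) - 1 := by
  have hg := 𝒢.one_le_gdim
  rcases Nat.eq_zero_or_pos 𝒢.s with hs | hs
  · haveI : IsEmpty (Fin 𝒢.s × Fin (m + 1)) := by rw [hs]; infer_instance
    rw [totalDegree_eq_zero_of_isEmpty]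
    exact Nat.zero_le _
  · have h := 𝒢.totalDegree_normFormPoly_le (⟨0, hs⟩, 0) hR hR0
    rw [← gdim_eq_ideg] at h
    refine h.trans ?_
    have : 𝒢.gdim * (𝒢.s * ν + 1) = 𝒢.s * 𝒢.gdim * ν + 𝒢.gdim := by ring
    rw [this]
    omega

/-- **The heart: a form `R` of degree `ν` with `φ(R) = 0` (orders up to `n = sν`) lies in `𝔭`.**
[cite: NesterenkoPhilippon2001, Ch. 10 Lemma 3.1 (p. 153), proof = [Nes3] Thm 1] -/
theorem mem_of_phi_eq_zero {ν : ℕ} {R : Rx m} (hR : R.IsHomogeneous ν)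
    (hφ : 𝒢.phi (𝒢.s * ν) R = 0) : R ∈ 𝒢.𝔭 := by
  by_contra hRp
  have hR0 : R ≠ 0 := fun h0 => hRp (h0 ▸ 𝒢.𝔭.zero_mem)
  set n := 𝒢.s * ν with hn
  -- (A) all coordinates of all derivatives of `y = R(ρ)` of order `≤ n` specialise to `0`
  have hA : 𝒢.CVan n (𝒢.aevalO R) := by
    refine 𝒢.CVan_of_chart R fun w' hw' hlen i => ?_
    have hle : ∀ p, 𝒢.chartCount w' p ≤ n := fun p =>
      (Finset.single_le_sum (fun _ _ => Nat.zero_le _) (Finset.mem_univ p)).trans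
        ((𝒢.sum_chartCount hw').le.trans hlen)
    let k : 𝒢.KIdx n := ⟨fun p => ⟨𝒢.chartCount w' p, Nat.lt_succ_of_le (hle p)⟩, by
      change ∑ p, 𝒢.chartCount w' p ≤ n; rw [𝒢.sum_chartCount hw']; exact hlen⟩
    have h1 := congrFun (congrFun hφ k) i
    rw [phi_apply, Pi.zero_apply, Pi.zero_apply] at h1
    rw [𝒢.iterD_eq_iterD_canWord hw']
    exact h1
  -- (B) every coordinate of `y` vanishes to order `n`
  have hB := 𝒢.van_crdO_of_CVan n (𝒢.aevalO R) hA
  -- (C) so do the entries of the multiplication matrix, (D) hence its determinant to order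
  -- `D(n+1) − 1`
  have hC : ∀ i i', 𝒢.van n (𝒢.mulMatO (𝒢.aevalO R) i i') := fun i i' =>
    VanUpTo.sum fun i'' _ => (hB i'').mul_right _
  have hD : 𝒢.van (𝒢.gdim * (n + 1) - 1) (𝒢.mulMatO (𝒢.aevalO R)).det :=
    VanUpTo.det 𝒢.one_le_gdim hC
  -- (E) the norm form `a^ν N(y) = normFormPoly R ν` vanishes to the same order
  set NF : 𝒢.O0 := algebraMap (RU 𝒢.s m) 𝒢.O0 (𝒢.normFormPoly R ν) with hNF
  have hNFeq : NF = algebraMap (RU 𝒢.s m) 𝒢.O0 (aLead 𝒢.s 𝒢.j (chowForm 𝒢.𝔭 (𝒢.s + 1))) ^ ν *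
      (𝒢.mulMatO (𝒢.aevalO R)).det := by
    refine Subtype.ext ?_
    rw [hNF, coe_algebraMap_O0, algebraMap_normFormPoly 𝒢 hR hR0, MulMemClass.coe_mul,
      SubmonoidClass.coe_pow, coe_algebraMap_O0, coe_det_mulMatO]
    rfl
  have hE : 𝒢.van (𝒢.gdim * (n + 1) - 1) NF := by
    rw [hNFeq]; exact hD.mul_left _
  -- (F) all partial derivatives of `normFormPoly R ν` of order `≤ D(n+1) − 1 ≥ its degree` vanish
  -- at `uspec`: it is zero — contradiction
  have hF : 𝒢.normFormPoly R ν = 0 := by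
    refine eq_zero_of_forall_eval_iterD_pderiv 𝒢.uspec fun w hw => ?_
    have hw' : w.length ≤ 𝒢.gdim * (n + 1) - 1 :=
      hw.trans (𝒢.totalDegree_normFormPoly_le_budget hR hR0)
    rw [← tau_iterD_algebraMap]
    exact hE w hw'
  exact 𝒢.normFormPoly_ne_zero hR hRp hF

/-! ### The bound -/

/-- **Nesterenko's bound for the Hilbert function, absolute case** (LNM 1752 Ch. 10 Lemma 3.1 /
[Nes3] Thm 1 over the constant field `ℚ`): for a homogeneous prime `𝔭` of rank `s + 1` with a
chart and every `ν`,
`dim_ℚ ℚ[x̲]_ν ≤ dim_ℚ 𝔭_ν + deg 𝔭 · #{k ∈ ℕ^s : |k| ≤ sν}`.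
[cite: NesterenkoPhilippon2001, Ch. 10 Lemma 3.1 (p. 153)] -/
theorem finrank_homogeneousSubmodule_le (ν : ℕ) :
    finrank ℚ (homogeneousSubmodule (Fin (m + 1)) ℚ ν) ≤
      finrank ℚ (idealDegree 𝒢.𝔭 ν) + ideg 𝒢.𝔭 (𝒢.s + 1) * Fintype.card (𝒢.KIdx (𝒢.s * ν)) := by
  haveI := finite_homogeneousSubmodule (K := ℚ) (σ := Fin (m + 1)) ν
  let f := (𝒢.phi (𝒢.s * ν)).comp (homogeneousSubmodule (Fin (m + 1)) ℚ ν).subtype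
  have hker : (LinearMap.ker f).map (homogeneousSubmodule (Fin (m + 1)) ℚ ν).subtype ≤
      idealDegree 𝒢.𝔭 ν := by
    rintro x ⟨v, hv, rfl⟩
    have hv' : f v = 0 := hv
    exact ⟨𝒢.mem_of_phi_eq_zero v.2 hv', v.2⟩
  have h1 := LinearMap.finrank_range_add_finrank_ker f
  have h2 : finrank ℚ (LinearMap.ker f) ≤ finrank ℚ (idealDegree 𝒢.𝔭 ν) := by
    rw [← Submodule.finrank_map_subtype_eq (homogeneousSubmodule (Fin (m + 1)) ℚ ν) (LinearMap.ker f)]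
    exact Submodule.finrank_mono hker
  have h3 : finrank ℚ (LinearMap.range f) ≤ ideg 𝒢.𝔭 (𝒢.s + 1) * Fintype.card (𝒢.KIdx (𝒢.s * ν)) := by
    refine (Submodule.finrank_le _).trans ?_
    rw [Module.finrank_pi_fintype, Finset.sum_const, Finset.card_univ, smul_eq_mul,
      Module.finrank_fintype_fun_eq_card, Fintype.card_fin, gdim_eq_ideg, mul_comm]
  calc finrank ℚ (homogeneousSubmodule (Fin (m + 1)) ℚ ν)
      = finrank ℚ (LinearMap.range f) + finrank ℚ (LinearMap.ker f) := h1.symm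
    _ ≤ ideg 𝒢.𝔭 (𝒢.s + 1) * Fintype.card (𝒢.KIdx (𝒢.s * ν)) + finrank ℚ (idealDegree 𝒢.𝔭 ν) :=
      Nat.add_le_add h3 h2
    _ = _ := add_comm _ _

/-- **The Hilbert function bound** `H(𝔭; ν) ≤ deg 𝔭 · (sν + 1)^s` (rank `s + 1`; for `s = 0`,
`H(𝔭; ν) ≤ deg 𝔭`). [cite: NesterenkoPhilippon2001, Ch. 10 Lemma 3.1 (p. 153)] -/
theorem hilbert_le (ν : ℕ) :
    finrank ℚ (homogeneousSubmodule (Fin (m + 1)) ℚ ν) - finrank ℚ (idealDegree 𝒢.𝔭 ν) ≤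
      ideg 𝒢.𝔭 (𝒢.s + 1) * (𝒢.s * ν + 1) ^ 𝒢.s := by
  have h1 := 𝒢.finrank_homogeneousSubmodule_le ν
  have h2 := Nat.mul_le_mul_left (ideg 𝒢.𝔭 (𝒢.s + 1)) (𝒢.card_KIdx_le (𝒢.s * ν))
  omega

/-- **LNM 1752 Ch. 10 Lemma 3.2, constant field** (the Siegel-type existence step of the
multiplicity estimate): if `dim_ℚ ℚ[x̲]_ν = binom(ν + m, m) > deg 𝔭 · (sν + 1)^s`, then `𝔭` contains a
non-zero form of degree exactly `ν`. [cite: NesterenkoPhilippon2001, Ch. 10 Lemma 3.2 (p. 153)] -/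
theorem exists_isHomogeneous_mem_ne_zero {ν : ℕ}
    (h : ideg 𝒢.𝔭 (𝒢.s + 1) * (𝒢.s * ν + 1) ^ 𝒢.s < finrank ℚ (homogeneousSubmodule (Fin (m + 1)) ℚ ν)) :
    ∃ P ∈ 𝒢.𝔭, P.IsHomogeneous ν ∧ P ≠ 0 := by
  have hpos : 0 < finrank ℚ (idealDegree 𝒢.𝔭 ν) := by
    have := 𝒢.hilbert_le ν
    omega
  have hne : idealDegree 𝒢.𝔭 ν ≠ ⊥ := fun hbot => by
    rw [← Submodule.finrank_eq_zero (R := ℚ)] at hbot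
    omega
  obtain ⟨P, hP, hP0⟩ := Submodule.exists_mem_ne_zero_of_ne_bot hne
  exact ⟨P, hP.1, hP.2, hP0⟩

/-! ### A form of small degree (Cor. 3.3 over the constant field) -/

/-- Arithmetic: `binom(ν + m, m) ≥ (ν+1)^m / m!`. [folklore] -/
theorem pow_le_factorial_mul_choose (ν m : ℕ) : (ν + 1) ^ m ≤ m.factorial * (ν + m).choose ν := by
  rw [Nat.choose_symm_add, ← Nat.ascFactorial_eq_factorial_mul_choose]
  exact Nat.pow_succ_le_ascFactorial (ν + 1) m

/-- Arithmetic: `(sν + 1)^s ≤ s^s (ν + 1)^s`. [folklore] -/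
theorem pow_mul_add_one_le (s ν : ℕ) : (s * ν + 1) ^ s ≤ s ^ s * (ν + 1) ^ s := by
  rcases Nat.eq_zero_or_pos s with hs | hs
  · subst hs; simp
  · rw [← mul_pow]
    exact Nat.pow_le_pow_left (by nlinarith) s

/-- **A non-zero form of degree `≤ m!·s^s · (deg 𝔭)^{1/(m−s)}` in a homogeneous prime `𝔭` of rank
`s + 1 < m + 1`** (LNM 1752 Ch. 10 Cor. 3.3 over the constant field: the least `ν` with
`binom(ν+m, m) > deg 𝔭 · (sν+1)^s`). [cite: NesterenkoPhilippon2001, Ch. 10 Cor. 3.3 (p. 154)] -/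
theorem exists_form_degree_le_rpow (hsm : 𝒢.s < m) :
    ∃ (P : Rx m) (ν : ℕ), P ∈ 𝒢.𝔭 ∧ P.IsHomogeneous ν ∧ P ≠ 0 ∧
      (ν : ℝ) ≤ (m.factorial * 𝒢.s ^ 𝒢.s : ℕ) * (ideg 𝒢.𝔭 (𝒢.s + 1) : ℝ) ^ (1 / (m - 𝒢.s : ℝ)) := by
  set g := ideg 𝒢.𝔭 (𝒢.s + 1) with hg
  set Mc : ℕ := m.factorial * 𝒢.s ^ 𝒢.s * g with hMc
  have hn : m - 𝒢.s ≠ 0 := by omega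
  set x : ℝ := (Mc : ℝ) ^ ((m - 𝒢.s : ℕ) : ℝ)⁻¹ with hx
  have hx0 : 0 ≤ x := Real.rpow_nonneg (Nat.cast_nonneg _) _
  set ν : ℕ := ⌊x⌋₊ with hν
  -- `Mc < (ν + 1)^(m − s)`
  have hlt : (Mc : ℝ) < ((ν + 1 : ℕ) : ℝ) ^ (m - 𝒢.s) := by
    have h1 : x < (ν + 1 : ℕ) := by push_cast; exact Nat.lt_floor_add_one x
    have h2 : x ^ (m - 𝒢.s) < ((ν + 1 : ℕ) : ℝ) ^ (m - 𝒢.s) := pow_lt_pow_left₀ h1 hx0 hn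
    rwa [hx, Real.rpow_inv_natCast_pow (Nat.cast_nonneg _) hn] at h2
  have hltN : Mc < (ν + 1) ^ (m - 𝒢.s) := by exact_mod_cast hlt
  -- the counting inequality of Lemma 3.2
  have hcount : g * (𝒢.s * ν + 1) ^ 𝒢.s < (ν + m).choose ν := by
    have h1 : m.factorial * (g * (𝒢.s * ν + 1) ^ 𝒢.s) ≤ Mc * (ν + 1) ^ 𝒢.s := by
      rw [hMc]
      calc m.factorial * (g * (𝒢.s * ν + 1) ^ 𝒢.s)
          ≤ m.factorial * (g * (𝒢.s ^ 𝒢.s * (ν + 1) ^ 𝒢.s)) :=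
            Nat.mul_le_mul_left _ (Nat.mul_le_mul_left _ (pow_mul_add_one_le _ _))
        _ = m.factorial * 𝒢.s ^ 𝒢.s * g * (ν + 1) ^ 𝒢.s := by ring
    have h2 : Mc * (ν + 1) ^ 𝒢.s < (ν + 1) ^ m := by
      calc Mc * (ν + 1) ^ 𝒢.s < (ν + 1) ^ (m - 𝒢.s) * (ν + 1) ^ 𝒢.s :=
            Nat.mul_lt_mul_of_pos_right hltN (pow_pos (Nat.succ_pos _) _)
        _ = (ν + 1) ^ m := by rw [← pow_add, Nat.sub_add_cancel hsm.le]
    have h3 := pow_le_factorial_mul_choose ν m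
    have : m.factorial * (g * (𝒢.s * ν + 1) ^ 𝒢.s) < m.factorial * (ν + m).choose ν := by omega
    exact Nat.lt_of_mul_lt_mul_left this
  obtain ⟨P, hP, hPh, hP0⟩ := 𝒢.exists_isHomogeneous_mem_ne_zero (ν := ν)
    (by rw [Literature.RingTheory.HilbertSamuel.finrank_homogeneousSubmodule_fin]; exact hcount)
  refine ⟨P, ν, hP, hPh, hP0, ?_⟩
  -- `ν ≤ x ≤ (m! s^s) g^{1/(m−s)}`
  have hνx : (ν : ℝ) ≤ x := Nat.floor_le hx0
  refine hνx.trans ?_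
  have hexp : ((m - 𝒢.s : ℕ) : ℝ)⁻¹ = 1 / (m - 𝒢.s : ℝ) := by
    rw [one_div, Nat.cast_sub hsm.le]
  have he1 : ((m - 𝒢.s : ℕ) : ℝ)⁻¹ ≤ 1 := by
    rw [inv_le_one_iff₀]
    right
    exact_mod_cast Nat.one_le_iff_ne_zero.mpr hn
  have hC1 : (1 : ℝ) ≤ (m.factorial * 𝒢.s ^ 𝒢.s : ℕ) := by
    have hss : 0 < 𝒢.s ^ 𝒢.s := by
      rcases Nat.eq_zero_or_pos 𝒢.s with hs | hs
      · rw [hs]; exact Nat.one_pos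
      · exact Nat.pow_pos hs
    exact_mod_cast Nat.mul_pos (Nat.factorial_pos m) hss
  rw [hx, hMc, show ((m.factorial * 𝒢.s ^ 𝒢.s * g : ℕ) : ℝ) =
      ((m.factorial * 𝒢.s ^ 𝒢.s : ℕ) : ℝ) * (g : ℝ) by push_cast; ring,
    Real.mul_rpow (Nat.cast_nonneg _) (Nat.cast_nonneg _), ← hexp]
  refine mul_le_mul_of_nonneg_right ?_ (Real.rpow_nonneg (Nat.cast_nonneg _) _)
  calc ((m.factorial * 𝒢.s ^ 𝒢.s : ℕ) : ℝ) ^ ((m - 𝒢.s : ℕ) : ℝ)⁻¹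
      ≤ ((m.factorial * 𝒢.s ^ 𝒢.s : ℕ) : ℝ) ^ (1 : ℝ) := Real.rpow_le_rpow_of_exponent_le hC1 he1
    _ = _ := Real.rpow_one _

end GSec

/-- **Cor. 3.3 over the constant field, for a homogeneous prime of `ℚ[x₀, …, x_m]`**: a homogeneous
prime `𝔭` with `dim ℚ[x̲]/𝔭 = s + 1`, `s < m`, and a chart contains a non-zero form of degree
`ν ≤ m!·s^s·(deg 𝔭)^{1/(m−s)}`. [cite: NesterenkoPhilippon2001, Ch. 10 Cor. 3.3 (p. 154)] -/
theorem exists_form_degree_le_rpow_of_isPrime {𝔭 : Ideal (Rx m)} (h𝔭 : 𝔭.IsPrime)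
    (hhom : 𝔭.IsHomogeneous (homogeneousSubmodule (Fin (m + 1)) ℚ)) {s : ℕ} (hsm : s < m)
    (hdim : ringKrullDim (Rx m ⧸ 𝔭) = (s + 1 : ℕ)) {j : Fin (m + 1)} (hj : (X j : Rx m) ∉ 𝔭) :
    ∃ (P : Rx m) (ν : ℕ), P ∈ 𝔭 ∧ P.IsHomogeneous ν ∧ P ≠ 0 ∧
      (ν : ℝ) ≤ (m.factorial * s ^ s : ℕ) * (ideg 𝔭 (s + 1) : ℝ) ^ (1 / (m - s : ℝ)) :=
  GSec.exists_form_degree_le_rpow ⟨𝔭, s, j, h𝔭, hhom, hj, hdim⟩ hsm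

/-- The dimension of the forms of degree `ν` in `m + 1` variables. [folklore] -/
theorem finrank_homogeneousSubmodule_eq (m ν : ℕ) :
    finrank ℚ (homogeneousSubmodule (Fin (m + 1)) ℚ ν) = (ν + m).choose ν := by
  rw [Literature.RingTheory.HilbertSamuel.finrank_homogeneousSubmodule_fin]
  rfl

/-! ### The statement for a homogeneous prime ideal -/

/-- **Nesterenko's Hilbert-function bound for a homogeneous prime of `ℚ[x₀, …, x_m]`** (absolute
case of LNM 1752 Ch. 10 Lemma 3.1): if `𝔭` is a homogeneous prime with `dim ℚ[x̲]/𝔭 = s + 1` (a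
proper such prime misses some variable), then for every `ν`,
`H(𝔭; ν) = dim ℚ[x̲]_ν − dim 𝔭_ν ≤ deg 𝔭 · (sν + 1)^s`, where `deg 𝔭 = ideg 𝔭 (s + 1)` is the degree
of the associated (Chow) form. [cite: NesterenkoPhilippon2001, Ch. 10 Lemma 3.1 (p. 153)] -/
theorem hilbert_le_of_isPrime {𝔭 : Ideal (Rx m)} (h𝔭 : 𝔭.IsPrime)
    (hhom : 𝔭.IsHomogeneous (homogeneousSubmodule (Fin (m + 1)) ℚ)) {s : ℕ}
    (hdim : ringKrullDim (Rx m ⧸ 𝔭) = (s + 1 : ℕ)) {j : Fin (m + 1)} (hj : (X j : Rx m) ∉ 𝔭) (ν : ℕ) :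
    finrank ℚ (homogeneousSubmodule (Fin (m + 1)) ℚ ν) - finrank ℚ (idealDegree 𝔭 ν) ≤
      ideg 𝔭 (s + 1) * (s * ν + 1) ^ s :=
  GSec.hilbert_le ⟨𝔭, s, j, h𝔭, hhom, hj, hdim⟩ ν

/-- **LNM 1752 Ch. 10 Lemma 3.2 over the constant field**: under the same hypotheses, if
`binom(ν + m, m) > deg 𝔭 · (sν + 1)^s` then `𝔭` contains a non-zero form of degree `ν`.
[cite: NesterenkoPhilippon2001, Ch. 10 Lemma 3.2 (p. 153)] -/
theorem exists_isHomogeneous_mem_ne_zero_of_isPrime {𝔭 : Ideal (Rx m)} (h𝔭 : 𝔭.IsPrime)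
    (hhom : 𝔭.IsHomogeneous (homogeneousSubmodule (Fin (m + 1)) ℚ)) {s : ℕ}
    (hdim : ringKrullDim (Rx m ⧸ 𝔭) = (s + 1 : ℕ)) {j : Fin (m + 1)} (hj : (X j : Rx m) ∉ 𝔭) {ν : ℕ}
    (h : ideg 𝔭 (s + 1) * (s * ν + 1) ^ s < (ν + m).choose ν) :
    ∃ P ∈ 𝔭, P.IsHomogeneous ν ∧ P ≠ 0 := by
  have := finrank_homogeneousSubmodule_eq m ν
  exact GSec.exists_isHomogeneous_mem_ne_zero ⟨𝔭, s, j, h𝔭, hhom, hj, hdim⟩ (by rw [this]; exact h)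

end Nesterenko

end Literature.NumberTheory.Transcendental
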